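import Literature.NumberTheory.LFunctions.WeilWindowSuzuki
import Literature.NumberTheory.LFunctions.WeilDilationVirial
import Literature.NumberTheory.LFunctions.WeilMarkovQuadratic
import Literature.Analysis.SpecialFunctions.DigammaVerticalAsymptotics
import HarnessLib

/-!
# Continuity of the bottom of the truncated Weil form in the window (Suzuki 2026, Thm. 1.3): proofs

Sibling proof file of `Literature/NumberTheory/LFunctions/WeilWindowSuzuki.lean`, next to
`WeilWindowSuzukiProofs.lean` (which proves Thm. 1.4); same normalisation:
additive variable `t = log x`, test functions `IsWeilTest`, `ĝ(s) = weilMellin g s`,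
`Q(g) = weilQuadratic g = W(g ⋆ g̃)`, `W = weilPolarTerm − weilPrimeTerm + weilArchTerm`, ground energy
`ε(a) = weilGroundEnergy a = inf {Re Q(g) : g test, tsupport g ⊆ [-a, a], ∫ |g|² = 1}`. It DISCHARGES
the claim `Literature.NumberTheory.LFunctions.Suzuki2026_thm_1_3`:

  `ContinuousOn weilGroundEnergy (Ioi 0)` — "the lowest eigenvalue `λ_a` is continuous in `a`"
  (M. Suzuki, *Weil's quadratic form via the screw function*, arXiv:2606.09096, Thm. 1.3; `λ_a = ε(a)`
  by Cor. 1.2, the infimum of the Rayleigh quotient over `C_c^∞(−a, a)`).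

Everything here is proved; there are no named facts and no new definitions.

## Source and proof

Suzuki (§4, read on the held text, pp. 12–13) transfers the Rayleigh quotient to the fixed interval
`[-1, 1]` (`w(t) = v(at)`), where by the expansion of the screw function at the origin (logarithmic
singularity, (2.2)) it reads
`R(a, w) = −log a − (2A+1) + 𝓛(w)/‖w‖² − Σ_{n ≤ e^{2a}} Λ(n) n^{-1/2} (translation terms)(log n / a, w)
  − a ∬ r''(a(x−y)) w(y) w̄(x)` (4.5), with the scale-free closed form
`𝓛(w) = (1/2π) ∫ (log|z| + C₀) |ŵ(z)|² dz` (4.6), whose form norm is the `H^{log}` norm. Then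
* upper semicontinuity `limsup_{a→a₀} λ_a ≤ λ_{a₀}` (§4.3): `λ_a ≤ R(a, w_n) → R(a₀, w_n)` for FIXED
  smooth `w_n`, and `inf_n R(a₀, w_n) = λ_{a₀}`;
* lower semicontinuity `liminf λ_{a_n} ≥ λ_{a₀}` (§4.4): minimisers `w_n` of `λ_{a_n}` are bounded in
  `H^{log}(-1, 1)`, hence `L²`-precompact (Prop. 4.1, the compact embedding `H^{log} ↪ L²` of [CCM25]);
  the `a`-independent closed part is `L²`-lower semicontinuous and the remainder `q̄ₐ¹` ("a finite sum
  of quadratic forms associated with translation operators and integral operators with continuous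
  kernels") is continuous in `(a, w)`.

The Lean proof keeps the mechanism — scale covariance of the logarithmic singularity, and uniform
control of translations of energy-bounded functions through the `H^{log}` weight — but runs it
minimiser-free and operator-free, directly on the tree's `sInf` over smooth test functions (so neither
the Friedrichs extension `A_a` of Thm. 1.1 nor the existence of minimisers nor Prop. 4.1 is needed):

1. `ρ(t) = Re ψ(1/4 + it/2)` (`reDigammaQuarter`, the archimedean weight: `(1/2π) ∫ |ĝ|² ρ` is the
   archimedean integral of `Q`, `weilArchIntegral_weilConv_weilReflect`): increments
   `|ρ(s) − ρ(t)| ≤ 27 |s² − t²|` (vertical series), `ρ(M) → ∞`, and a doubling bound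
   `|ρ(s) − ρ(t)| ≤ D` for `|s| ≤ 2|t| ≤ 4|s|` (`ψ(1/4 + iy) = log(1+|y|) + O(1)`,
   `DigammaVerticalAsymptotics`).
2. Translation modulus (`two_pi_mul_weilIncrement_le`): by Plancherel for `g(·+h) − g`,
   `2π ∫|g(x+h) − g(x)|² dx = ∫ |e^{-iuh} − 1|² |ĝ(1/2+iu)|² du ≤ h²M² ∫|ĝ|² + (4/(ρ(M) − ρ(0))) B(g)`,
   `B(g) = ∫ |ĝ|² (ρ − ρ(0))` — the `H^{log}` tail control, uniform on energy-bounded sets since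
   `B(g) ≤ 2π (Re Q(g) + C(a) ‖g‖₂²)` (`integral_norm_sq_weilMellin_mul_sub_le`, Bombieri's bounds for
   the polar and prime terms).
3. Dilation `g_η(t) = (1+η)^{1/2} g((1+η)t)` (`weilDilate`, Bombieri's `f_ε`; `Q(g_η) = W(k((1+η)·))`,
   `k = g ⋆ g̃`, `weilQuadratic_weilDilate`): the polar and prime terms change by those of the difference
   kernel `d = k((1+η)·) − k`, supported in `[-4a, 4a]` and bounded pointwise by increments of `k`, i.e.
   (Cauchy–Schwarz, `norm_weilConv_weilReflect_sub_le`) by the translation modulus at lengths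
   `≤ 4a|η|`; the archimedean integral becomes `∫ |ĝ(1/2+iu)|² ρ((1+η)u) du`
   (`weilArchIntegral_comp_mul_weilConv_weilReflect`), and `|ρ((1+η)u) − ρ(u)|` is `≤ 81|η| M²` on
   `|u| ≤ M` and `≤ D` beyond, where the mass of `|ĝ|²` is `≤ B(g)/(ρ(M) − ρ(0))`.
4. Master estimate (`abs_re_weilQuadratic_weilDilate_sub_le`) ⇒ uniform modulus
   (`exists_weilDilate_modulus`): `|Re Q(g_η) − Re Q(g)| ≤ ε` for `|η| ≤ δ(a, E, ε)`, uniformly over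
   normalised test `g` on `[-a, a]` with `Re Q(g) ≤ E` (choose `λ`, then `M`, then `δ`).
5. `continuousAt_weilGroundEnergy`: near `a₀`, `ε(a) ≤ ε(a₀) + ε` by dilating a near-minimiser of
   the window `a₀` into the window `a` (Suzuki's §4.3 / Bombieri's Thm. 5 variation), and
   `ε(a) ≥ ε(a₀) − ε` by dilating every element of the unit sphere of the window `a` with
   `Re Q ≤ ε(a₀) + 1` into the window `a₀` (the uniformity replacing §4.4).

Deliberately NOT here: Lipschitz or Hölder moduli of `ε` (the argument gives a `1/√(log(1/h))`-type
modulus only; cf. route `WeilWindowFlow`, item `WindowLipschitz`), monotonicity of `ε`, minimisers.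

## References

* M. Suzuki, *Weil's quadratic form via the screw function*, arXiv:2606.09096 (2026), Thm. 1.3, §4
  (Prop. 4.1, (4.5)–(4.6), §4.3, §4.4). (key `Suzuki2026`)
* E. Bombieri, *Remarks on Weil's quadratic functional in the theory of prime numbers I*, Rend. Mat.
  Acc. Lincei (9) 11 (2000), §4: Lemma 2, Lemma 3, Thm. 3 (lower bound), Thm. 5 (the dilation `f_ε`).
  (key `Bombieri2000Weil`)
* A. Connes, C. Consani, H. Moscovici, *Zeta spectral triples*, arXiv:2511.22755 (2025) = [CCM25]
  (compact embedding `H^{log} ↪ L²`; background only).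
-/

noncomputable section

open Complex Filter Set MeasureTheory
open scoped Real Topology ComplexConjugate ArithmeticFunction.vonMangoldt

namespace Literature.NumberTheory.LFunctions

open Literature.Analysis.SpecialFunctions

variable {g : ℝ → ℂ}

/-! ## The archimedean weight `ρ(t) = Re ψ(1/4 + it/2)`: increments, growth, doubling -/

/-- Increment bound of the weight: `ρ(t) − ρ(u) ≤ 27 (t² − u²)` for `u² ≤ t²` (termwise
`f_l(t) − f_l(u) = 2l(t² − u²)/((l² + t²)(l² + u²)) ≤ 2(t² − u²)/l³ ≤ 16 (t² − u²)/(m+1)²` in the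
vertical series, and `16 π²/6 ≤ 27`). [folklore] -/
theorem reDigammaQuarter_sub_le_mul_sq_sub {t u : ℝ} (h : u ^ 2 ≤ t ^ 2) :
    reDigammaQuarter t - reDigammaQuarter u ≤ 27 * (t ^ 2 - u ^ 2) := by
  have hsub := (hasSum_digammaTerm t).sub (hasSum_digammaTerm u)
  have hS := hasSum_one_div_nat_add_one_sq.mul_left (16 * (t ^ 2 - u ^ 2))
  have hle := hasSum_le (f := fun m : ℕ ↦ digammaTerm (digammaNode m) t - digammaTerm (digammaNode m) u)
    (g := fun m : ℕ ↦ 16 * (t ^ 2 - u ^ 2) * (1 / ((m : ℝ) + 1) ^ 2)) (fun m ↦ ?_) hsub hS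
  · have hpi : π ^ 2 / 6 ≤ 10 / 6 := by
      have := Real.pi_lt_d2
      have h0 := Real.pi_pos.le
      exact div_le_div_of_nonneg_right (by nlinarith) (by norm_num)
    have htu : 0 ≤ t ^ 2 - u ^ 2 := sub_nonneg.2 h
    nlinarith
  · have hl := digammaNode_pos m
    have htu : 0 ≤ t ^ 2 - u ^ 2 := sub_nonneg.2 h
    show digammaTerm (digammaNode m) t - digammaTerm (digammaNode m) u ≤
      16 * (t ^ 2 - u ^ 2) * (1 / ((m : ℝ) + 1) ^ 2)
    rw [digammaTerm_sub hl]
    set l := digammaNode m with hl'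
    calc 2 * l * (t ^ 2 - u ^ 2) / ((l ^ 2 + t ^ 2) * (l ^ 2 + u ^ 2))
        ≤ 2 * l * (t ^ 2 - u ^ 2) / (l ^ 2 * l ^ 2) := by
          refine div_le_div_of_nonneg_left (by positivity) (by positivity) ?_
          exact mul_le_mul (by nlinarith [sq_nonneg t]) (by nlinarith [sq_nonneg u])
            (by positivity) (by positivity)
      _ = (t ^ 2 - u ^ 2) * (2 / l ^ 3) := by
          field_simp
      _ ≤ (t ^ 2 - u ^ 2) * (16 * (1 / ((m : ℝ) + 1) ^ 2)) :=
          mul_le_mul_of_nonneg_left (two_div_digammaNode_cube_le m) htu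
      _ = 16 * (t ^ 2 - u ^ 2) * (1 / ((m : ℝ) + 1) ^ 2) := by ring

/-- `|ρ(s) − ρ(t)| ≤ 27 |s² − t²|` for all `s, t`. [folklore] -/
theorem abs_reDigammaQuarter_sub_le_mul_abs (s t : ℝ) :
    |reDigammaQuarter s - reDigammaQuarter t| ≤ 27 * |s ^ 2 - t ^ 2| := by
  rcases le_total (t ^ 2) (s ^ 2) with h | h
  · rw [abs_of_nonneg (sub_nonneg.2 (reDigammaQuarter_mono (sq_le_sq.1 h))),
      abs_of_nonneg (sub_nonneg.2 h)]
    exact reDigammaQuarter_sub_le_mul_sq_sub h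
  · rw [abs_sub_comm, abs_of_nonneg (sub_nonneg.2 (reDigammaQuarter_mono (sq_le_sq.1 h))),
      abs_sub_comm, abs_of_nonneg (sub_nonneg.2 h)]
    exact reDigammaQuarter_sub_le_mul_sq_sub h

/-- Strict growth away from the origin: `ρ(0) < ρ(M)` for `M ≠ 0` (the first term `f_{1/2}(M) > 0`
of the vertical series). [folklore] -/
theorem reDigammaQuarter_zero_lt {M : ℝ} (hM : M ≠ 0) :
    reDigammaQuarter 0 < reDigammaQuarter M := by
  have h := sum_digammaTerm_le 1 M
  simp only [Finset.range_one, Finset.sum_singleton] at h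
  have hpos : 0 < digammaTerm (digammaNode 0) M := by
    unfold digammaTerm
    have hl := digammaNode_pos 0
    have hM2 : 0 < M ^ 2 := by positivity
    positivity
  linarith

/-- Two-sided logarithmic size of the weight: `|ρ(t) − log(1 + |t|/2)| ≤ C` for all `t`
(`ψ(1/4 + iy) = log(1 + |y|) + O(1)`, `Literature.Analysis.SpecialFunctions.Complex.exists_norm_digamma_sub_log_le_of_pos`). [folklore] -/
theorem exists_abs_reDigammaQuarter_sub_log_le :
    ∃ C : ℝ, ∀ t : ℝ, |reDigammaQuarter t - Real.log (1 + |t| / 2)| ≤ C := by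
  obtain ⟨C, hC⟩ :=
    Literature.Analysis.SpecialFunctions.Complex.exists_norm_digamma_sub_log_le_of_pos
      (a := 1 / 4) (by norm_num)
  refine ⟨C, fun t ↦ ?_⟩
  have h := hC (t / 2)
  have hw : ((1 / 4 : ℝ) : ℂ) + ((t / 2 : ℝ) : ℂ) * I = 1 / 4 + (t : ℂ) / 2 * I := by
    push_cast
    ring
  rw [hw] at h
  have habs : |t / 2| = |t| / 2 := by rw [abs_div, abs_two]
  rw [habs] at h
  have hre : (Complex.digamma (1 / 4 + (t : ℂ) / 2 * I) - (Real.log (1 + |t| / 2) : ℂ)).re =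
      reDigammaQuarter t - Real.log (1 + |t| / 2) := by
    simp only [Complex.sub_re, Complex.ofReal_re, reDigammaQuarter]
  rw [← hre]
  exact (Complex.abs_re_le_norm _).trans h

/-- The weight tends to `+∞`: `ρ(M) → ∞` as `M → ∞`. [folklore] -/
theorem tendsto_reDigammaQuarter_atTop : Tendsto reDigammaQuarter atTop atTop := by
  obtain ⟨C, hC⟩ := exists_abs_reDigammaQuarter_sub_log_le
  have hlog : Tendsto (fun t : ℝ ↦ Real.log (1 + |t| / 2) - C) atTop atTop := by
    refine tendsto_atTop_add_const_right _ (-C) ?_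
    refine Real.tendsto_log_atTop.comp ?_
    refine tendsto_atTop_add_const_left _ 1 ?_
    refine Tendsto.atTop_div_const (by norm_num : (0 : ℝ) < 2) ?_
    exact tendsto_abs_atTop_atTop
  refine tendsto_atTop_mono (fun t ↦ ?_) hlog
  have h := hC t
  rw [abs_le] at h
  linarith [h.1]

/-- **Doubling bound**: there is `D` with `|ρ(s) − ρ(t)| ≤ D` whenever `|s| ≤ 2|t|` and
`|t| ≤ 2|s|` (from the two-sided logarithmic size and `log 2`). [folklore] -/
theorem exists_abs_reDigammaQuarter_sub_le_of_comparable :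
    ∃ D : ℝ, 0 ≤ D ∧ ∀ s t : ℝ, |s| ≤ 2 * |t| → |t| ≤ 2 * |s| →
      |reDigammaQuarter s - reDigammaQuarter t| ≤ D := by
  obtain ⟨C, hC⟩ := exists_abs_reDigammaQuarter_sub_log_le
  have hC0 : 0 ≤ C := (abs_nonneg _).trans (hC 0)
  refine ⟨2 * C + Real.log 2, by positivity, fun s t hst hts ↦ ?_⟩
  have h1 := hC s
  have h2 := hC t
  have hlog : |Real.log (1 + |s| / 2) - Real.log (1 + |t| / 2)| ≤ Real.log 2 := by
    have hs0 : 0 < 1 + |s| / 2 := by positivity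
    have ht0 : 0 < 1 + |t| / 2 := by positivity
    rw [abs_le]
    constructor
    · -- `log(1+|t|/2) ≤ log 2 + log(1+|s|/2)`
      have : Real.log (1 + |t| / 2) ≤ Real.log (2 * (1 + |s| / 2)) :=
        Real.log_le_log ht0 (by linarith)
      rw [Real.log_mul two_ne_zero hs0.ne'] at this
      linarith
    · have : Real.log (1 + |s| / 2) ≤ Real.log (2 * (1 + |t| / 2)) :=
        Real.log_le_log hs0 (by linarith)
      rw [Real.log_mul two_ne_zero ht0.ne'] at this
      linarith
  rw [abs_le] at h1 h2 hlog ⊢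
  constructor <;> linarith [h1.1, h1.2, h2.1, h2.2, hlog.1, hlog.2]

/-! ## Linear bookkeeping for test functions -/

/-- Differences of test functions are test functions. [folklore] -/
theorem IsWeilTest.sub {g h : ℝ → ℂ} (hg : IsWeilTest g) (hh : IsWeilTest h) :
    IsWeilTest (g - h) := by
  have := hg.add (hh.const_mul (-1))
  convert this using 1
  funext t
  simp only [Pi.sub_apply, Pi.add_apply]
  ring

/-- `(g − h)^ = ĝ − ĥ` for continuous compactly supported `g, h`. [folklore] -/
theorem weilMellin_sub {g h : ℝ → ℂ} (hg : Continuous g) (hg' : HasCompactSupport g)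
    (hh : Continuous h) (hh' : HasCompactSupport h) (s : ℂ) :
    weilMellin (g - h) s = weilMellin g s - weilMellin h s := by
  unfold weilMellin
  rw [← integral_sub (integrable_weilIntegrand hg hg' s) (integrable_weilIntegrand hh hh' s)]
  congr 1 with t
  simp only [Pi.sub_apply]
  ring

/-- The prime term is additive on compactly supported kernels: `P(g − h) = P(g) − P(h)`. [folklore] -/
theorem weilPrimeTerm_sub {g h : ℝ → ℂ} (hg' : HasCompactSupport g) (hh' : HasCompactSupport h) :
    weilPrimeTerm (g - h) = weilPrimeTerm g - weilPrimeTerm h := by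
  unfold weilPrimeTerm
  rw [← (summable_weilPrimeTerm hg').tsum_sub (summable_weilPrimeTerm hh')]
  refine tsum_congr fun n ↦ ?_
  simp only [Pi.sub_apply]
  ring

/-! ## The translation modulus through Plancherel -/

/-- **The increment form on the Fourier side**: for a test function `g` and `h ∈ ℝ`,
`2π ∫ |g(x + h) − g(x)|² dx = ∫ |e^{-iuh} − 1|² |ĝ(1/2 + iu)|² du`
(Plancherel for the test function `g(· + h) − g`, whose transform is `(e^{-(s-1/2)h} − 1) ĝ(s)`). [folklore] -/
theorem two_pi_mul_weilIncrement_eq (hg : IsWeilTest g) (h : ℝ) :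
    2 * π * weilIncrement g h =
      ∫ u : ℝ, ‖cexp (I * ((-(u * h) : ℝ) : ℂ)) - 1‖ ^ 2 * ‖weilMellin g (1 / 2 + u * I)‖ ^ 2 := by
  set φ : ℝ → ℂ := weilTranslate g (-h) - g with hφ
  have hτ : IsWeilTest (weilTranslate g (-h)) := hg.weilTranslate (-h)
  have hφt : IsWeilTest φ := hτ.sub hg
  have hP := integral_norm_sq_weilMellin_half_line hφt
  have hN : weilNorm2Sq φ = weilIncrement g h := by
    unfold weilNorm2Sq weilIncrement
    congr 1 with x
    simp [hφ, weilTranslate, sub_neg_eq_add]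
  have hM : ∀ u : ℝ, weilMellin φ (1 / 2 + u * I) =
      (cexp (I * ((-(u * h) : ℝ) : ℂ)) - 1) * weilMellin g (1 / 2 + u * I) := by
    intro u
    rw [hφ, weilMellin_sub hτ.1.continuous hτ.2 hg.1.continuous hg.2, weilMellin_weilTranslate]
    have e : ((1 / 2 : ℂ) + u * I - 1 / 2) * ((-h : ℝ) : ℂ) = I * ((-(u * h) : ℝ) : ℂ) := by
      push_cast
      ring
    rw [e]
    ring
  rw [hN] at hP
  rw [← hP]
  congr 1 with u
  rw [hM, norm_mul, mul_pow]

/-- Pointwise bound for the translation multiplier: for `M` with `ρ(0) < ρ(M)` and all `u`,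
`|e^{-iuh} − 1|² ≤ h² M² + 4 (ρ(u) − ρ(0))/(ρ(M) − ρ(0))`
(`|e^{ix} − 1| ≤ min(|x|, 2)`; for `|u| > M` the ratio is `≥ 1` by monotonicity of `ρ`). [folklore] -/
theorem norm_exp_sub_one_sq_le (h u : ℝ) {M : ℝ} (hM : reDigammaQuarter 0 < reDigammaQuarter M) :
    ‖cexp (I * ((-(u * h) : ℝ) : ℂ)) - 1‖ ^ 2 ≤
      h ^ 2 * M ^ 2 + 4 * ((reDigammaQuarter u - reDigammaQuarter 0) /
        (reDigammaQuarter M - reDigammaQuarter 0)) := by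
  have hratio : 0 ≤ (reDigammaQuarter u - reDigammaQuarter 0) /
      (reDigammaQuarter M - reDigammaQuarter 0) :=
    div_nonneg (sub_nonneg.2 (reDigammaQuarter_zero_le u)) (sub_nonneg.2 hM.le)
  rcases le_or_gt |u| |M| with hu | hu
  · -- `|u| ≤ |M|`: `|e^{ix} − 1|² ≤ x² = u² h² ≤ M² h²`
    have h1 : ‖cexp (I * ((-(u * h) : ℝ) : ℂ)) - 1‖ ≤ |u * h| := by
      have := Real.norm_exp_I_mul_ofReal_sub_one_le (x := -(u * h))
      rwa [Real.norm_eq_abs, abs_neg] at this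
    have h2 : ‖cexp (I * ((-(u * h) : ℝ) : ℂ)) - 1‖ ^ 2 ≤ (u * h) ^ 2 := by
      rw [← sq_abs (u * h)]
      exact pow_le_pow_left₀ (norm_nonneg _) h1 2
    have h3 : (u * h) ^ 2 ≤ h ^ 2 * M ^ 2 := by
      rw [mul_pow, mul_comm]
      refine mul_le_mul_of_nonneg_left ?_ (sq_nonneg h)
      rw [← sq_abs u, ← sq_abs M]
      exact pow_le_pow_left₀ (abs_nonneg u) hu 2
    linarith [mul_nonneg (by norm_num : (0 : ℝ) ≤ 4) hratio]
  · -- `|u| > |M|`: `|e^{ix} − 1|² ≤ 4 ≤ 4 · ratio`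
    have h1 : ‖cexp (I * ((-(u * h) : ℝ) : ℂ)) - 1‖ ≤ 2 := by
      refine (norm_sub_le _ _).trans ?_
      rw [Complex.norm_exp_I_mul_ofReal, norm_one]
      norm_num
    have h2 : ‖cexp (I * ((-(u * h) : ℝ) : ℂ)) - 1‖ ^ 2 ≤ 2 ^ 2 :=
      pow_le_pow_left₀ (norm_nonneg _) h1 2
    have h3 : 1 ≤ (reDigammaQuarter u - reDigammaQuarter 0) /
        (reDigammaQuarter M - reDigammaQuarter 0) := by
      rw [le_div_iff₀ (sub_pos.2 hM), one_mul]
      linarith [reDigammaQuarter_mono hu.le]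
    nlinarith [sq_nonneg h, sq_nonneg M, mul_nonneg (sq_nonneg h) (sq_nonneg M)]

/-- **Uniform translation modulus from the logarithmic energy.** For a test function `g`, `h ∈ ℝ`
and `M` with `ρ(0) < ρ(M)`:
`2π ∫ |g(x+h) − g(x)|² dx ≤ h² M² ∫ |ĝ(1/2+iu)|² du + (4/(ρ(M) − ρ(0))) ∫ |ĝ(1/2+iu)|² (ρ(u) − ρ(0)) du`.
The second integral is the excess of the archimedean energy over its minimum; this is the
`H^{log}`-control of translations behind the compact embedding `H^{log} ↪ L²`
(Suzuki 2026, Prop. 4.1; Connes–Consani–Moscovici 2025), here in the elementary quantitative form that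
the proof below needs. [folklore] -/
theorem two_pi_mul_weilIncrement_le (hg : IsWeilTest g) (h : ℝ) {M : ℝ}
    (hM : reDigammaQuarter 0 < reDigammaQuarter M) :
    2 * π * weilIncrement g h ≤
      h ^ 2 * M ^ 2 * (∫ u : ℝ, ‖weilMellin g (1 / 2 + u * I)‖ ^ 2) +
        4 / (reDigammaQuarter M - reDigammaQuarter 0) *
          ∫ u : ℝ, ‖weilMellin g (1 / 2 + u * I)‖ ^ 2 *
            (reDigammaQuarter u - reDigammaQuarter 0) := by
  rw [two_pi_mul_weilIncrement_eq hg h]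
  have hI1 : Integrable fun u : ℝ ↦ ‖weilMellin g (1 / 2 + u * I)‖ ^ 2 :=
    integrable_norm_sq_weilMellin_half_line hg
  have hI2 : Integrable fun u : ℝ ↦ ‖weilMellin g (1 / 2 + u * I)‖ ^ 2 *
      (reDigammaQuarter u - reDigammaQuarter 0) := by
    refine integrable_norm_sq_weilMellin_mul hg
      (measurable_reDigammaQuarter.sub measurable_const) (A := 0) (B := 27) le_rfl (by norm_num)
      fun u ↦ ?_
    rw [abs_of_nonneg (sub_nonneg.2 (reDigammaQuarter_zero_le u)), zero_add]
    exact reDigammaQuarter_sub_le u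
  set R : ℝ := reDigammaQuarter M - reDigammaQuarter 0 with hR
  have hRpos : 0 < R := sub_pos.2 hM
  calc ∫ u : ℝ, ‖cexp (I * ((-(u * h) : ℝ) : ℂ)) - 1‖ ^ 2 * ‖weilMellin g (1 / 2 + u * I)‖ ^ 2
      ≤ ∫ u : ℝ, (h ^ 2 * M ^ 2 + 4 * ((reDigammaQuarter u - reDigammaQuarter 0) / R)) *
          ‖weilMellin g (1 / 2 + u * I)‖ ^ 2 := by
        refine integral_mono_of_nonneg (Eventually.of_forall fun u ↦ by positivity) ?_
          (Eventually.of_forall fun u ↦ ?_)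
        · have : (fun u : ℝ ↦ (h ^ 2 * M ^ 2 + 4 * ((reDigammaQuarter u - reDigammaQuarter 0) / R)) *
              ‖weilMellin g (1 / 2 + u * I)‖ ^ 2) =
              fun u : ℝ ↦ h ^ 2 * M ^ 2 * ‖weilMellin g (1 / 2 + u * I)‖ ^ 2 +
                4 / R * (‖weilMellin g (1 / 2 + u * I)‖ ^ 2 *
                  (reDigammaQuarter u - reDigammaQuarter 0)) := by
            funext u; ring
          rw [this]
          exact (hI1.const_mul _).add (hI2.const_mul _)
        · exact mul_le_mul_of_nonneg_right (norm_exp_sub_one_sq_le h u hM) (sq_nonneg _)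
    _ = h ^ 2 * M ^ 2 * (∫ u : ℝ, ‖weilMellin g (1 / 2 + u * I)‖ ^ 2) +
          4 / R * ∫ u : ℝ, ‖weilMellin g (1 / 2 + u * I)‖ ^ 2 *
            (reDigammaQuarter u - reDigammaQuarter 0) := by
        rw [← integral_const_mul, ← integral_const_mul, ← integral_add (hI1.const_mul _)
          (hI2.const_mul _)]
        congr 1 with u
        ring

/-! ## Increments of the autocorrelation `k = g ⋆ g̃` -/

/-- **Increments of the autocorrelation are controlled by the translation modulus**: for a test
function `g`, `k = g ⋆ g̃` and every `λ > 0`,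
`|k(s) − k(s')| ≤ (λ ‖g‖₂² + λ⁻¹ ∫ |g(x + (s − s')) − g(x)|² dx)/2`
(`k(s) − k(s') = ∫ g(u) conj(g(u−s) − g(u−s')) du` and `2|xy| ≤ λ|x|² + λ⁻¹|y|²`; optimising in `λ`
gives Cauchy–Schwarz). [folklore] -/
theorem norm_weilConv_weilReflect_sub_le (hg : IsWeilTest g) (s s' : ℝ) {lam : ℝ} (hlam : 0 < lam) :
    ‖weilConv g (weilReflect g) s - weilConv g (weilReflect g) s'‖ ≤
      (lam * (∫ x : ℝ, ‖g x‖ ^ 2) + lam⁻¹ * weilIncrement g (s - s')) / 2 := by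
  have hgc : Continuous g := hg.1.continuous
  have hI : ∀ r : ℝ, Integrable fun u : ℝ ↦ g u * conj (g (u - r)) := fun r ↦
    (hgc.mul (Complex.continuous_conj.comp (hgc.comp (continuous_sub_right r)))).integrable_of_hasCompactSupport
      hg.2.mul_right
  have hk : ∀ r : ℝ, weilConv g (weilReflect g) r = ∫ u : ℝ, g u * conj (g (u - r)) := fun r ↦ by
    rw [weilConv_apply]
    congr 1 with u
    simp [weilReflect, neg_sub]
  have h2 : Integrable fun u : ℝ ↦ ‖g u‖ ^ 2 := hg.integrable_norm_sq
  have hD : Integrable fun u : ℝ ↦ ‖g (u - s) - g (u - s')‖ ^ 2 := by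
    have h := integrable_weilIncrement_integrand hg.memLp_two (s' - s)
    have h' := h.comp_sub_right s'
    refine h'.congr (Eventually.of_forall fun u ↦ ?_)
    simp only [show u - s' + (s' - s) = u - s by ring]
  have hDeq : ∫ u : ℝ, ‖g (u - s) - g (u - s')‖ ^ 2 = weilIncrement g (s - s') := by
    rw [weilIncrement, ← integral_sub_right_eq_self (fun x : ℝ ↦ ‖g (x + (s - s')) - g x‖ ^ 2) s]
    congr 1 with u
    rw [show u - s + (s - s') = u - s' by ring, norm_sub_rev]
  rw [hk s, hk s', ← integral_sub (hI s) (hI s')]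
  calc ‖∫ u : ℝ, (g u * conj (g (u - s)) - g u * conj (g (u - s')))‖
      ≤ ∫ u : ℝ, ‖g u * conj (g (u - s)) - g u * conj (g (u - s'))‖ :=
        norm_integral_le_integral_norm _
    _ ≤ ∫ u : ℝ, (lam * ‖g u‖ ^ 2 + lam⁻¹ * ‖g (u - s) - g (u - s')‖ ^ 2) / 2 := by
        refine integral_mono_of_nonneg (Eventually.of_forall fun _ ↦ norm_nonneg _)
          (((h2.const_mul lam).add (hD.const_mul lam⁻¹)).div_const 2)
          (Eventually.of_forall fun u ↦ ?_)
        dsimp only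
        have e : g u * conj (g (u - s)) - g u * conj (g (u - s')) =
            g u * conj (g (u - s) - g (u - s')) := by
          rw [map_sub]; ring
        rw [e, norm_mul, Complex.norm_conj]
        -- `2 x y ≤ λ x² + λ⁻¹ y²`
        set x := ‖g u‖
        set y := ‖g (u - s) - g (u - s')‖
        have hsl : 0 < Real.sqrt lam := Real.sqrt_pos.2 hlam
        have key := two_mul_le_add_sq (Real.sqrt lam * x) (y / Real.sqrt lam)
        have e1 : 2 * (Real.sqrt lam * x) * (y / Real.sqrt lam) = 2 * (x * y) := by
          field_simp
        have e2 : (Real.sqrt lam * x) ^ 2 = lam * x ^ 2 := by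
          rw [mul_pow, Real.sq_sqrt hlam.le]
        have e3 : (y / Real.sqrt lam) ^ 2 = lam⁻¹ * y ^ 2 := by
          rw [div_pow, Real.sq_sqrt hlam.le]
          ring
        rw [e1, e2, e3] at key
        linarith
    _ = (lam * (∫ x : ℝ, ‖g x‖ ^ 2) + lam⁻¹ * weilIncrement g (s - s')) / 2 := by
        rw [integral_div, integral_add (h2.const_mul lam) (hD.const_mul lam⁻¹), integral_const_mul,
          integral_const_mul, hDeq]


/-! ## The archimedean integral under rescaling -/

/-- **The archimedean integral of a rescaled autocorrelation, Fourier side**: for a test function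
`g`, `k = g ⋆ g̃` and `c > 0`, `∫ (k(c·))^(1/2+it) Re ψ(1/4+it/2) dt = ∫ |ĝ(1/2+iu)|² ρ(cu) du`
(`(k(c·))^(1/2+it) = c⁻¹ k̂(1/2 + it/c) = c⁻¹ |ĝ(1/2+it/c)|²`, then `u = t/c`). The logarithmic
singularity of the weight is scale covariant: `ρ(cu) − ρ(u) → log c` at infinity. [folklore] -/
theorem weilArchIntegral_comp_mul_weilConv_weilReflect (hg : IsWeilTest g) {c : ℝ} (hc : 0 < c) :
    weilArchIntegral (fun t ↦ weilConv g (weilReflect g) (c * t)) =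
      ((∫ u : ℝ, ‖weilMellin g (1 / 2 + u * I)‖ ^ 2 * reDigammaQuarter (c * u) : ℝ) : ℂ) := by
  have hc0 : c ≠ 0 := hc.ne'
  have hc0' : (c : ℂ) ≠ 0 := Complex.ofReal_ne_zero.2 hc0
  set k := weilConv g (weilReflect g) with hk
  have h1 : ∀ t : ℝ, weilMellin (fun x ↦ k (c * x)) (1 / 2 + t * I) =
      (c : ℂ)⁻¹ * ((‖weilMellin g (1 / 2 + ((c⁻¹ * t : ℝ) : ℂ) * I)‖ ^ 2 : ℝ) : ℂ) := by
    intro t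
    rw [weilMellin_comp_mul k hc]
    have e : (1 / 2 : ℂ) + (1 / 2 + t * I - 1 / 2) / (c : ℂ) = 1 / 2 + ((c⁻¹ * t : ℝ) : ℂ) * I := by
      push_cast
      field_simp
      ring
    rw [e, hk, weilMellin_weilConv_weilReflect_half hg]
  have h2 : (fun t : ℝ ↦ weilMellin (fun x ↦ k (c * x)) (1 / 2 + t * I) *
      ((Complex.digamma (1 / 4 + t / 2 * I)).re : ℂ)) =
      fun t : ℝ ↦ ((c⁻¹ * (‖weilMellin g (1 / 2 + ((c⁻¹ * t : ℝ) : ℂ) * I)‖ ^ 2 *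
        reDigammaQuarter t) : ℝ) : ℂ) := by
    funext t
    rw [h1 t]
    simp only [reDigammaQuarter]
    push_cast
    ring
  unfold weilArchIntegral
  rw [h2, integral_complex_ofReal]
  congr 1
  set G : ℝ → ℝ := fun u ↦ ‖weilMellin g (1 / 2 + (u : ℂ) * I)‖ ^ 2 * reDigammaQuarter (c * u)
    with hG
  have hGc : ∀ t : ℝ, G (c⁻¹ * t) =
      ‖weilMellin g (1 / 2 + ((c⁻¹ * t : ℝ) : ℂ) * I)‖ ^ 2 * reDigammaQuarter t := by
    intro t
    simp only [hG, mul_inv_cancel_left₀ hc0]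
  calc ∫ t : ℝ, c⁻¹ * (‖weilMellin g (1 / 2 + ((c⁻¹ * t : ℝ) : ℂ) * I)‖ ^ 2 * reDigammaQuarter t)
      = c⁻¹ * ∫ t : ℝ, G (c⁻¹ * t) := by
        rw [integral_const_mul]
        congr 1
        exact integral_congr_ae (Eventually.of_forall fun t ↦ (hGc t).symm)
    _ = c⁻¹ * (|c| • ∫ u : ℝ, G u) := by rw [Measure.integral_comp_inv_mul_left]
    _ = ∫ u : ℝ, G u := by
        rw [abs_of_pos hc, smul_eq_mul, ← mul_assoc, inv_mul_cancel₀ hc0, one_mul]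

/-- The unscaled case (`c = 1`), real form of `weilArchIntegral_weilConv_weilReflect`:
`Re ∫ k̂(1/2+it) Re ψ(1/4+it/2) dt = ∫ |ĝ(1/2+iu)|² ρ(u) du`. [folklore] -/
theorem weilArchIntegral_weilConv_weilReflect_re (hg : IsWeilTest g) :
    (weilArchIntegral (weilConv g (weilReflect g))).re =
      ∫ u : ℝ, ‖weilMellin g (1 / 2 + u * I)‖ ^ 2 * reDigammaQuarter u := by
  rw [weilArchIntegral_weilConv_weilReflect hg, Complex.ofReal_re]
  rfl

/-- `u ↦ |ĝ(1/2+iu)|² ρ(cu)` is integrable (`|ρ(cu)| ≤ |ρ(0)| + 27 c² u²`). [folklore] -/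
theorem integrable_norm_sq_weilMellin_mul_reDigammaQuarter_comp_mul (hg : IsWeilTest g) (c : ℝ) :
    Integrable fun u : ℝ ↦ ‖weilMellin g (1 / 2 + u * I)‖ ^ 2 * reDigammaQuarter (c * u) := by
  refine integrable_norm_sq_weilMellin_mul hg
    (measurable_reDigammaQuarter.comp (measurable_const_mul c)) (A := |reDigammaQuarter 0|)
    (B := 27 * c ^ 2) (abs_nonneg _) (by positivity) fun u ↦ ?_
  have h := abs_reDigammaQuarter_le (c * u)
  calc |reDigammaQuarter (c * u)| ≤ |reDigammaQuarter 0| + 27 * (c * u) ^ 2 := h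
    _ = |reDigammaQuarter 0| + 27 * c ^ 2 * u ^ 2 := by ring

/-- **The archimedean term under rescaling.** For a test function `g`, `1/2 ≤ c ≤ 2`, `M` with
`ρ(0) < ρ(M)` and a doubling constant `D` of `ρ`:
`|∫ |ĝ|² ρ(cu) − ∫ |ĝ|² ρ(u)| ≤ 27 |c² − 1| M² ∫ |ĝ|² + (D/(ρ(M) − ρ(0))) ∫ |ĝ|² (ρ − ρ(0))`
(pointwise `|ρ(cu) − ρ(u)| ≤ 27 |c² − 1| u²` on `|u| ≤ |M|`, `≤ D` beyond, where
`(ρ(u) − ρ(0))/(ρ(M) − ρ(0)) ≥ 1`). [folklore] -/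
theorem abs_integral_norm_sq_weilMellin_mul_reDigammaQuarter_dilate_sub_le (hg : IsWeilTest g)
    {c : ℝ} (hc : 1 / 2 ≤ c) (hc2 : c ≤ 2) {M : ℝ} (hM : reDigammaQuarter 0 < reDigammaQuarter M)
    {D : ℝ} (hD0 : 0 ≤ D)
    (hD : ∀ s t : ℝ, |s| ≤ 2 * |t| → |t| ≤ 2 * |s| → |reDigammaQuarter s - reDigammaQuarter t| ≤ D) :
    |(∫ u : ℝ, ‖weilMellin g (1 / 2 + u * I)‖ ^ 2 * reDigammaQuarter (c * u)) -
        ∫ u : ℝ, ‖weilMellin g (1 / 2 + u * I)‖ ^ 2 * reDigammaQuarter u| ≤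
      27 * |c ^ 2 - 1| * M ^ 2 * (∫ u : ℝ, ‖weilMellin g (1 / 2 + u * I)‖ ^ 2) +
        D / (reDigammaQuarter M - reDigammaQuarter 0) *
          ∫ u : ℝ, ‖weilMellin g (1 / 2 + u * I)‖ ^ 2 *
            (reDigammaQuarter u - reDigammaQuarter 0) := by
  set R : ℝ := reDigammaQuarter M - reDigammaQuarter 0 with hR
  have hRpos : 0 < R := sub_pos.2 hM
  have hcpos : 0 < c := by linarith
  have hI1 : Integrable fun u : ℝ ↦ ‖weilMellin g (1 / 2 + u * I)‖ ^ 2 :=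
    integrable_norm_sq_weilMellin_half_line hg
  have hI2 : Integrable fun u : ℝ ↦ ‖weilMellin g (1 / 2 + u * I)‖ ^ 2 *
      (reDigammaQuarter u - reDigammaQuarter 0) := by
    refine integrable_norm_sq_weilMellin_mul hg
      (measurable_reDigammaQuarter.sub measurable_const) (A := 0) (B := 27) le_rfl (by norm_num)
      fun u ↦ ?_
    rw [abs_of_nonneg (sub_nonneg.2 (reDigammaQuarter_zero_le u)), zero_add]
    exact reDigammaQuarter_sub_le u
  have hIc := integrable_norm_sq_weilMellin_mul_reDigammaQuarter_comp_mul hg c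
  have hI0 := integrable_norm_sq_weilMellin_mul_reDigammaQuarter_comp_mul hg 1
  simp only [one_mul] at hI0
  -- pointwise bound on the weight
  have hpt : ∀ u : ℝ, |reDigammaQuarter (c * u) - reDigammaQuarter u| ≤
      27 * |c ^ 2 - 1| * M ^ 2 + D * ((reDigammaQuarter u - reDigammaQuarter 0) / R) := by
    intro u
    have hratio : 0 ≤ (reDigammaQuarter u - reDigammaQuarter 0) / R :=
      div_nonneg (sub_nonneg.2 (reDigammaQuarter_zero_le u)) hRpos.le
    rcases le_or_gt |u| |M| with hu | hu
    · have h1 := abs_reDigammaQuarter_sub_le_mul_abs (c * u) u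
      have h2 : |(c * u) ^ 2 - u ^ 2| = |c ^ 2 - 1| * u ^ 2 := by
        rw [show (c * u) ^ 2 - u ^ 2 = (c ^ 2 - 1) * u ^ 2 by ring, abs_mul, abs_of_nonneg (sq_nonneg u)]
      have h3 : u ^ 2 ≤ M ^ 2 := by
        rw [← sq_abs u, ← sq_abs M]
        exact pow_le_pow_left₀ (abs_nonneg u) hu 2
      rw [h2] at h1
      have h4 : 27 * (|c ^ 2 - 1| * u ^ 2) ≤ 27 * |c ^ 2 - 1| * M ^ 2 := by
        rw [mul_assoc]
        exact mul_le_mul_of_nonneg_left (mul_le_mul_of_nonneg_left h3 (abs_nonneg _)) (by norm_num)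
      linarith [mul_nonneg hD0 hratio]
    · have h1 : |reDigammaQuarter (c * u) - reDigammaQuarter u| ≤ D := by
        refine hD (c * u) u ?_ ?_
        · rw [abs_mul, abs_of_pos hcpos]
          nlinarith [abs_nonneg u]
        · rw [abs_mul, abs_of_pos hcpos]
          nlinarith [abs_nonneg u]
      have h3 : 1 ≤ (reDigammaQuarter u - reDigammaQuarter 0) / R := by
        rw [le_div_iff₀ hRpos, one_mul]
        linarith [reDigammaQuarter_mono hu.le]
      have h4 : D ≤ D * ((reDigammaQuarter u - reDigammaQuarter 0) / R) :=
        le_mul_of_one_le_right hD0 h3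
      have h5 : 0 ≤ 27 * |c ^ 2 - 1| * M ^ 2 := by positivity
      linarith
  rw [← integral_sub hIc hI0]
  calc |∫ u : ℝ, (‖weilMellin g (1 / 2 + u * I)‖ ^ 2 * reDigammaQuarter (c * u) -
          ‖weilMellin g (1 / 2 + u * I)‖ ^ 2 * reDigammaQuarter u)|
      ≤ ∫ u : ℝ, |‖weilMellin g (1 / 2 + u * I)‖ ^ 2 * reDigammaQuarter (c * u) -
          ‖weilMellin g (1 / 2 + u * I)‖ ^ 2 * reDigammaQuarter u| := by
        have := norm_integral_le_integral_norm (μ := volume)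
          (fun u : ℝ ↦ ‖weilMellin g (1 / 2 + u * I)‖ ^ 2 * reDigammaQuarter (c * u) -
            ‖weilMellin g (1 / 2 + u * I)‖ ^ 2 * reDigammaQuarter u)
        simpa only [Real.norm_eq_abs] using this
    _ ≤ ∫ u : ℝ, (27 * |c ^ 2 - 1| * M ^ 2) * ‖weilMellin g (1 / 2 + u * I)‖ ^ 2 +
          D / R * (‖weilMellin g (1 / 2 + u * I)‖ ^ 2 *
            (reDigammaQuarter u - reDigammaQuarter 0)) := by
        refine integral_mono_of_nonneg (Eventually.of_forall fun u ↦ abs_nonneg _)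
          ((hI1.const_mul _).add (hI2.const_mul _)) (Eventually.of_forall fun u ↦ ?_)
        dsimp only
        rw [← mul_sub, abs_mul, abs_of_nonneg (sq_nonneg _)]
        have h := mul_le_mul_of_nonneg_left (hpt u) (sq_nonneg ‖weilMellin g (1 / 2 + u * I)‖)
        refine h.trans (le_of_eq ?_)
        ring
    _ = 27 * |c ^ 2 - 1| * M ^ 2 * (∫ u : ℝ, ‖weilMellin g (1 / 2 + u * I)‖ ^ 2) +
          D / R * ∫ u : ℝ, ‖weilMellin g (1 / 2 + u * I)‖ ^ 2 *
            (reDigammaQuarter u - reDigammaQuarter 0) := by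
        rw [integral_add (hI1.const_mul _) (hI2.const_mul _), integral_const_mul, integral_const_mul]

/-! ## The logarithmic energy of a test function is controlled by `Q` -/

/-- **Energy bound.** For a test function `g` with `tsupport g ⊆ [-a, a]`, the excess archimedean
energy is bounded by the Weil form:
`∫ |ĝ(1/2+iu)|² (ρ(u) − ρ(0)) du ≤ 2π (Re Q(g) + (2(sinh a − a) + 2 Σ_{n ≤ e^{2a}} Λ(n)/√n + log π − ρ(0)) ‖g‖₂²)`
(`Re Q = Re P − Re Pr + (1/2π) ∫|ĝ|²ρ − ‖g‖₂² log π` with Yoshida's polar lower bound and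
Bombieri's prime bound, as in `weilQuadratic_re_ge_of_tsupport_subset`). [cite: Bombieri2000Weil, §4 Lemma 3 and Thm 3 (proof)] -/
theorem integral_norm_sq_weilMellin_mul_sub_le (hg : IsWeilTest g) {a : ℝ}
    (hsupp : tsupport g ⊆ Icc (-a) a) :
    ∫ u : ℝ, ‖weilMellin g (1 / 2 + u * I)‖ ^ 2 * (reDigammaQuarter u - reDigammaQuarter 0) ≤
      2 * π * ((weilQuadratic g).re +
        (2 * (Real.sinh a - a) + 2 * (∑ n ∈ Finset.range (⌊Real.exp (2 * a)⌋₊ + 1),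
          (Λ n : ℝ) / Real.sqrt n) + Real.log π - reDigammaQuarter 0) * ∫ t : ℝ, ‖g t‖ ^ 2) := by
  set N2 : ℝ := ∫ t : ℝ, ‖g t‖ ^ 2 with hN2
  set S : ℝ := ∑ n ∈ Finset.range (⌊Real.exp (2 * a)⌋₊ + 1), (Λ n : ℝ) / Real.sqrt n with hS
  set k : ℝ → ℂ := weilConv g (weilReflect g) with hk
  have hkt : IsWeilTest k := hg.weilConv hg.weilReflect
  have hks : tsupport k ⊆ Icc (-(2 * a)) (2 * a) :=
    tsupport_weilConv_weilReflect_subset hg.2 hsupp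
  have hpol : (weilPolarTerm k).re = 2 * (weilMellin g 0 * conj (weilMellin g 1)).re := by
    rw [hk, weilPolarTerm_weilConv_weilReflect hg, Complex.ofReal_re]
  have hpol_ge : -(2 * (Real.sinh a - a)) * N2 ≤ (weilPolarTerm k).re := by
    rw [hpol]
    exact Yoshida1992_polar_lower_bound hg hsupp
  have hprime : (weilPrimeTerm k).re ≤ 2 * N2 * S :=
    (Complex.re_le_norm _).trans
      (norm_weilPrimeTerm_le_of_tsupport_subset hkt.1.continuous hks
        (fun t ↦ norm_weilConv_weilReflect_le hg t))
  set A : ℝ := ∫ u : ℝ, ‖weilMellin g (1 / 2 + u * I)‖ ^ 2 * reDigammaQuarter u with hA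
  have harch : (weilArchTerm k).re = 1 / (2 * π) * A - N2 * Real.log π := by
    have e : weilArchTerm k = ((1 / (2 * π) * A - N2 * Real.log π : ℝ) : ℂ) := by
      unfold weilArchTerm
      rw [hk, weilArchIntegral_weilConv_weilReflect hg, weilConv_weilReflect_apply_zero]
      push_cast
      simp only [reDigammaQuarter] at hA
      rw [hA]
    rw [e, Complex.ofReal_re]
  have hQ : (weilQuadratic g).re =
      (weilPolarTerm k).re - (weilPrimeTerm k).re + (weilArchTerm k).re := by
    simp only [weilQuadratic, weilFunctional, hk, Complex.add_re, Complex.sub_re]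
  have hI1 : Integrable fun u : ℝ ↦ ‖weilMellin g (1 / 2 + u * I)‖ ^ 2 :=
    integrable_norm_sq_weilMellin_half_line hg
  have hI0 := integrable_norm_sq_weilMellin_mul_reDigammaQuarter_comp_mul hg 1
  simp only [one_mul] at hI0
  have hP : ∫ u : ℝ, ‖weilMellin g (1 / 2 + u * I)‖ ^ 2 = 2 * π * N2 :=
    integral_norm_sq_weilMellin_half_line hg
  have hB : ∫ u : ℝ, ‖weilMellin g (1 / 2 + u * I)‖ ^ 2 * (reDigammaQuarter u - reDigammaQuarter 0) =
      A - reDigammaQuarter 0 * (2 * π * N2) := by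
    rw [← hP, ← integral_const_mul, ← integral_sub hI0 (hI1.const_mul _)]
    congr 1 with u
    ring
  have hπ : (0 : ℝ) < 2 * π := by positivity
  have h1 : 1 / (2 * π) * A = (weilQuadratic g).re - (weilPolarTerm k).re + (weilPrimeTerm k).re +
      N2 * Real.log π := by
    rw [hQ, harch]; ring
  have h2 : A = 2 * π * ((weilQuadratic g).re - (weilPolarTerm k).re + (weilPrimeTerm k).re +
      N2 * Real.log π) := by
    rw [← h1]; field_simp
  rw [hB, h2]
  nlinarith [hpol_ge, hprime, Real.pi_pos]

/-! ## The difference kernel `d = k((1+η)·) − k` of a dilation -/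

section Dilation

variable {a η : ℝ}

/-- For `|η| ≤ 1/2` and `tsupport g ⊆ [-a, a]`, both `k((1+η)t)` and `k(t)` vanish for `|t| ≥ 4a`
(`k = g ⋆ g̃` is supported in `[-2a, 2a]` and `1 + η ≥ 1/2`). [folklore] -/
theorem weilConv_weilReflect_dilate_eq_zero (hg : IsWeilTest g) (hsupp : tsupport g ⊆ Icc (-a) a)
    (hη : |η| ≤ 1 / 2) {t : ℝ} (ht : 4 * a ≤ |t|) :
    weilConv g (weilReflect g) ((1 + η) * t) = 0 ∧ weilConv g (weilReflect g) t = 0 := by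
  have h1 : 1 / 2 ≤ 1 + η := by linarith [neg_abs_le η]
  refine ⟨weilConv_weilReflect_eq_zero_of_le_abs hg hsupp ?_,
    weilConv_weilReflect_eq_zero_of_le_abs hg hsupp (by linarith [abs_nonneg t])⟩
  rw [abs_mul, abs_of_pos (by linarith)]
  have : 1 / 2 * |t| ≤ (1 + η) * |t| := mul_le_mul_of_nonneg_right h1 (abs_nonneg t)
  linarith [abs_nonneg t]

/-- The difference kernel of a dilation is supported in `[-4a, 4a]` (`|η| ≤ 1/2`). [folklore] -/
theorem tsupport_dilate_sub_subset (hg : IsWeilTest g) (hsupp : tsupport g ⊆ Icc (-a) a)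
    (hη : |η| ≤ 1 / 2) :
    tsupport ((fun t ↦ weilConv g (weilReflect g) ((1 + η) * t)) - weilConv g (weilReflect g)) ⊆
      Icc (-(4 * a)) (4 * a) := by
  refine closure_minimal (fun t ht ↦ ?_) isClosed_Icc
  rw [Function.mem_support, Pi.sub_apply] at ht
  by_contra hmem
  have h4 : 4 * a ≤ |t| := by
    rw [mem_Icc, not_and_or, not_le, not_le] at hmem
    rcases hmem with h | h
    · linarith [neg_le_abs t]
    · linarith [le_abs_self t]
  obtain ⟨h1, h2⟩ := weilConv_weilReflect_dilate_eq_zero hg hsupp hη h4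
  exact ht (by rw [h1, h2, sub_zero])

/-- The difference kernel of a dilation is a test function (`η > -1`). [folklore] -/
theorem isWeilTest_dilate_sub (hg : IsWeilTest g) (hη : -1 < η) :
    IsWeilTest ((fun t ↦ weilConv g (weilReflect g) ((1 + η) * t)) - weilConv g (weilReflect g)) :=
  ((hg.weilConv hg.weilReflect).comp_mul (ne_of_gt (by linarith : (0 : ℝ) < 1 + η))).sub
    (hg.weilConv hg.weilReflect)

/-- **Pointwise bound for the difference kernel**: if every translation modulus of `g` at lengths
`|h| ≤ 4a|η|` is `≤ X`, then `|k((1+η)t) − k(t)| ≤ (λ ‖g‖₂² + λ⁻¹ X)/2` for all `t` and `λ > 0`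
(`k((1+η)t) − k(t)` is an increment of `k` of length `ηt`, `|ηt| ≤ 4a|η|` on the support). [folklore] -/
theorem norm_dilate_sub_le (hg : IsWeilTest g) (ha : 0 < a) (hsupp : tsupport g ⊆ Icc (-a) a)
    (hη : |η| ≤ 1 / 2) {X lam : ℝ} (hlam : 0 < lam)
    (hX : ∀ h : ℝ, |h| ≤ 4 * a * |η| → weilIncrement g h ≤ X) (t : ℝ) :
    ‖weilConv g (weilReflect g) ((1 + η) * t) - weilConv g (weilReflect g) t‖ ≤
      (lam * (∫ x : ℝ, ‖g x‖ ^ 2) + lam⁻¹ * X) / 2 := by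
  have hX0 : 0 ≤ X := (weilIncrement_nonneg g 0).trans (hX 0 (by rw [abs_zero]; positivity))
  rcases lt_or_ge |t| (4 * a) with ht | ht
  · have h := norm_weilConv_weilReflect_sub_le hg ((1 + η) * t) t hlam
    have hlen : |(1 + η) * t - t| ≤ 4 * a * |η| := by
      rw [show (1 + η) * t - t = η * t by ring, abs_mul, mul_comm (4 * a)]
      exact mul_le_mul_of_nonneg_left ht.le (abs_nonneg η)
    have h2 : lam⁻¹ * weilIncrement g ((1 + η) * t - t) ≤ lam⁻¹ * X :=
      mul_le_mul_of_nonneg_left (hX _ hlen) (inv_nonneg.2 hlam.le)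
    linarith
  · obtain ⟨h1, h2⟩ := weilConv_weilReflect_dilate_eq_zero hg hsupp hη ht
    rw [h1, h2, sub_zero, norm_zero]
    have : 0 ≤ ∫ x : ℝ, ‖g x‖ ^ 2 := integral_nonneg fun _ ↦ by positivity
    positivity

/-- **The polar term of a kernel supported in `[-T, T]` and bounded by `M₀`**:
`|d̂(0) + d̂(1)| ≤ 2 e^{T/2} (2T M₀)` (`|d̂(1/2 ± 1/2)| ≤ e^{T/2} ‖d‖₁` and `‖d‖₁ ≤ 2T M₀`). [folklore] -/
theorem norm_weilPolarTerm_le_of_tsupport_subset {d : ℝ → ℂ} (hd : IsWeilTest d) {T M₀ : ℝ}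
    (hT : 0 ≤ T) (hsupp : tsupport d ⊆ Icc (-T) T) (hM : ∀ t, ‖d t‖ ≤ M₀) :
    ‖weilPolarTerm d‖ ≤ 2 * (Real.exp (T / 2) * (2 * T * M₀)) := by
  have hN1 : weilNorm1 d ≤ 2 * T * M₀ := by
    unfold weilNorm1
    have hzero : ∀ x, x ∉ Icc (-T) T → ‖d x‖ = 0 := fun x hx ↦ by
      rw [norm_eq_zero]
      exact image_eq_zero_of_notMem_tsupport fun h ↦ hx (hsupp h)
    rw [← setIntegral_eq_integral_of_forall_compl_eq_zero hzero]
    have h := norm_setIntegral_le_of_norm_le_const (s := Icc (-T) T) (f := fun x ↦ ‖d x‖)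
      (μ := volume) (C := M₀) (by rw [Real.volume_Icc]; exact ENNReal.ofReal_lt_top)
      (fun x _ ↦ by rw [Real.norm_eq_abs, abs_norm]; exact hM x)
    rw [Real.volume_real_Icc_of_le (by linarith), Real.norm_eq_abs,
      abs_of_nonneg (integral_nonneg fun _ ↦ norm_nonneg _)] at h
    linarith
  have hN1nn : 0 ≤ weilNorm1 d := weilNorm1_nonneg d
  have h0 : ‖weilMellin d 0‖ ≤ Real.exp (T / 2) * weilNorm1 d := by
    have h := norm_weilMellin_add_half_le hd hsupp (-(1 / 2) : ℂ)
    have e1 : (-(1 / 2) : ℂ) + 1 / 2 = 0 := by ring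
    have e2 : |(-(1 / 2) : ℂ).re| * T = T / 2 := by norm_num; ring
    rwa [e1, e2] at h
  have h1 : ‖weilMellin d 1‖ ≤ Real.exp (T / 2) * weilNorm1 d := by
    have h := norm_weilMellin_add_half_le hd hsupp ((1 / 2) : ℂ)
    have e1 : ((1 / 2) : ℂ) + 1 / 2 = 1 := by ring
    have e2 : |((1 / 2) : ℂ).re| * T = T / 2 := by norm_num; ring
    rwa [e1, e2] at h
  have hexp : 0 ≤ Real.exp (T / 2) := (Real.exp_pos _).le
  calc ‖weilPolarTerm d‖ ≤ ‖weilMellin d 0‖ + ‖weilMellin d 1‖ := norm_add_le _ _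
    _ ≤ Real.exp (T / 2) * weilNorm1 d + Real.exp (T / 2) * weilNorm1 d := add_le_add h0 h1
    _ ≤ 2 * (Real.exp (T / 2) * (2 * T * M₀)) := by
        nlinarith [mul_le_mul_of_nonneg_left hN1 hexp]

/-- **The three terms of `Re Q` under a dilation.** For a test function `g` and `η > -1`, with
`k = g ⋆ g̃`, `k_η = k((1+η)·)` and `d = k_η − k`:
`Re Q(g_η) − Re Q(g) = Re P(d) − Re Pr(d) + (1/2π)(Re A(k_η) − Re A(k))`
(`Q(g_η) = W(k_η)`, `weilQuadratic_weilDilate`; `P`, `Pr`, `A` are additive and `k_η(0) = k(0)`). [folklore] -/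
theorem re_weilQuadratic_weilDilate_sub (hg : IsWeilTest g) (hη : -1 < η) :
    (weilQuadratic (weilDilate η g)).re - (weilQuadratic g).re =
      (weilPolarTerm ((fun t ↦ weilConv g (weilReflect g) ((1 + η) * t)) -
          weilConv g (weilReflect g))).re -
        (weilPrimeTerm ((fun t ↦ weilConv g (weilReflect g) ((1 + η) * t)) -
          weilConv g (weilReflect g))).re +
        1 / (2 * π) * ((weilArchIntegral (fun t ↦ weilConv g (weilReflect g) ((1 + η) * t))).re -
          (weilArchIntegral (weilConv g (weilReflect g))).re) := by
  rw [weilQuadratic_weilDilate g hη]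
  unfold weilQuadratic
  set k : ℝ → ℂ := weilConv g (weilReflect g) with hk
  set kc : ℝ → ℂ := fun t ↦ k ((1 + η) * t) with hkc
  have hkt : IsWeilTest k := hg.weilConv hg.weilReflect
  have hc0 : (1 + η) ≠ 0 := ne_of_gt (by linarith)
  have hkct : IsWeilTest kc := hkt.comp_mul hc0
  have hPol : weilPolarTerm (kc - k) = weilPolarTerm kc - weilPolarTerm k := by
    unfold weilPolarTerm
    rw [weilMellin_sub hkct.1.continuous hkct.2 hkt.1.continuous hkt.2,
      weilMellin_sub hkct.1.continuous hkct.2 hkt.1.continuous hkt.2]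
    ring
  have hPr : weilPrimeTerm (kc - k) = weilPrimeTerm kc - weilPrimeTerm k :=
    weilPrimeTerm_sub hkct.2 hkt.2
  have h0 : kc 0 = k 0 := by simp [hkc]
  have hπ : (1 / (2 * π) : ℂ) = ((1 / (2 * π) : ℝ) : ℂ) := by push_cast; ring
  simp only [weilFunctional, weilArchTerm, hPol, hPr, h0, Complex.sub_re, Complex.add_re, hπ,
    Complex.re_ofReal_mul]
  ring

/-- **Master estimate for one dilation.** Let `g` be a test function with `tsupport g ⊆ [-a, a]`,
`a > 0`, `‖g‖₂ = 1`, let `|η| ≤ 1/2`, `λ > 0`, `M` with `ρ(0) < ρ(M)`, and `D ≥ 0` a doubling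
constant of `ρ`. Put `R = ρ(M) − ρ(0)`, `B = ∫ |ĝ(1/2+iu)|² (ρ(u) − ρ(0)) du`,
`S = Σ_{n ≤ e^{4a}} Λ(n)/√n` and `X = 16 a² η² M² + 2B/(πR)`. Then
`|Re Q(g_η) − Re Q(g)| ≤ (16 a e^{2a} + 2S)(λ + λ⁻¹X)/2 + 81 |η| M² + D B/(2πR)`:
polar and prime terms through the difference kernel `d` (supported in `[-4a, 4a]`, bounded by
`(λ + λ⁻¹X)/2` via the translation modulus), archimedean term through the scale covariance of `ρ`. [folklore] -/
theorem abs_re_weilQuadratic_weilDilate_sub_le (hg : IsWeilTest g) (ha : 0 < a)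
    (hsupp : tsupport g ⊆ Icc (-a) a) (hN : ∫ t : ℝ, ‖g t‖ ^ 2 = 1) (hη : |η| ≤ 1 / 2)
    {lam : ℝ} (hlam : 0 < lam) {M : ℝ} (hM : reDigammaQuarter 0 < reDigammaQuarter M)
    {D : ℝ} (hD0 : 0 ≤ D)
    (hD : ∀ s t : ℝ, |s| ≤ 2 * |t| → |t| ≤ 2 * |s| → |reDigammaQuarter s - reDigammaQuarter t| ≤ D) :
    |(weilQuadratic (weilDilate η g)).re - (weilQuadratic g).re| ≤
      (16 * a * Real.exp (2 * a) +
          2 * ∑ n ∈ Finset.range (⌊Real.exp (4 * a)⌋₊ + 1), (Λ n : ℝ) / Real.sqrt n) *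
        ((lam + lam⁻¹ * (16 * a ^ 2 * η ^ 2 * M ^ 2 +
          2 * (∫ u : ℝ, ‖weilMellin g (1 / 2 + u * I)‖ ^ 2 *
            (reDigammaQuarter u - reDigammaQuarter 0)) /
            (π * (reDigammaQuarter M - reDigammaQuarter 0)))) / 2) +
      81 * |η| * M ^ 2 +
      D * (∫ u : ℝ, ‖weilMellin g (1 / 2 + u * I)‖ ^ 2 *
            (reDigammaQuarter u - reDigammaQuarter 0)) /
        (2 * π * (reDigammaQuarter M - reDigammaQuarter 0)) := by
  have hη1 : -1 < η := by linarith [neg_abs_le η]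
  have hc : 1 / 2 ≤ 1 + η := by linarith [neg_abs_le η]
  have hc2 : 1 + η ≤ 2 := by linarith [le_abs_self η]
  set R : ℝ := reDigammaQuarter M - reDigammaQuarter 0 with hR
  have hRpos : 0 < R := sub_pos.2 hM
  set B : ℝ := ∫ u : ℝ, ‖weilMellin g (1 / 2 + u * I)‖ ^ 2 *
    (reDigammaQuarter u - reDigammaQuarter 0) with hB
  set S : ℝ := ∑ n ∈ Finset.range (⌊Real.exp (4 * a)⌋₊ + 1), (Λ n : ℝ) / Real.sqrt n with hS
  set k : ℝ → ℂ := weilConv g (weilReflect g) with hk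
  set d : ℝ → ℂ := (fun t ↦ k ((1 + η) * t)) - k with hd
  have hB0 : 0 ≤ B := integral_nonneg fun u ↦
    mul_nonneg (sq_nonneg _) (sub_nonneg.2 (reDigammaQuarter_zero_le u))
  have hP : ∫ u : ℝ, ‖weilMellin g (1 / 2 + u * I)‖ ^ 2 = 2 * π := by
    rw [integral_norm_sq_weilMellin_half_line hg]
    unfold weilNorm2Sq
    rw [hN, mul_one]
  -- the translation modulus at lengths `≤ 4a|η|`
  set X : ℝ := 16 * a ^ 2 * η ^ 2 * M ^ 2 + 2 * B / (π * R) with hX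
  have hXmod : ∀ h : ℝ, |h| ≤ 4 * a * |η| → weilIncrement g h ≤ X := by
    intro h hh
    have h1 := two_pi_mul_weilIncrement_le hg h hM
    rw [hP] at h1
    have hh2 : h ^ 2 ≤ (4 * a * |η|) ^ 2 := by
      rw [← sq_abs h]; exact pow_le_pow_left₀ (abs_nonneg h) hh 2
    have hh3 : (4 * a * |η|) ^ 2 = 16 * a ^ 2 * η ^ 2 := by rw [mul_pow, sq_abs]; ring
    have hπ : 0 < π := Real.pi_pos
    -- `2π D_h ≤ h² M² 2π + (4/R) B`
    have h2 : weilIncrement g h ≤ h ^ 2 * M ^ 2 + 2 * B / (π * R) := by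
      have e : (4 / R * B) = 2 * π * (2 * B / (π * R)) := by
        field_simp
        ring
      rw [e, show h ^ 2 * M ^ 2 * (2 * π) = 2 * π * (h ^ 2 * M ^ 2) by ring, ← mul_add] at h1
      exact le_of_mul_le_mul_left h1 (by positivity)
    have h3 : h ^ 2 * M ^ 2 ≤ 16 * a ^ 2 * η ^ 2 * M ^ 2 := by
      rw [← hh3]; exact mul_le_mul_of_nonneg_right hh2 (sq_nonneg M)
    linarith
  -- the difference kernel
  have hdt : IsWeilTest d := isWeilTest_dilate_sub hg hη1
  have hds : tsupport d ⊆ Icc (-(4 * a)) (4 * a) := tsupport_dilate_sub_subset hg hsupp hη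
  set M₀ : ℝ := (lam + lam⁻¹ * X) / 2 with hM₀
  have hdM : ∀ t, ‖d t‖ ≤ M₀ := by
    intro t
    have h := norm_dilate_sub_le hg ha hsupp hη hlam hXmod t
    rw [hN, mul_one] at h
    exact h
  have hPol : ‖weilPolarTerm d‖ ≤ 2 * (Real.exp (4 * a / 2) * (2 * (4 * a) * M₀)) :=
    norm_weilPolarTerm_le_of_tsupport_subset hdt (by positivity) hds hdM
  have hPr : ‖weilPrimeTerm d‖ ≤ 2 * M₀ * S :=
    norm_weilPrimeTerm_le_of_tsupport_subset hdt.1.continuous hds hdM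
  -- the archimedean term
  have hA : |(weilArchIntegral (fun t ↦ k ((1 + η) * t))).re - (weilArchIntegral k).re| ≤
      27 * |(1 + η) ^ 2 - 1| * M ^ 2 * (2 * π) + D / R * B := by
    rw [hk, weilArchIntegral_comp_mul_weilConv_weilReflect hg (by linarith), Complex.ofReal_re,
      weilArchIntegral_weilConv_weilReflect_re hg, ← hP]
    exact abs_integral_norm_sq_weilMellin_mul_reDigammaQuarter_dilate_sub_le hg hc hc2 hM hD0 hD
  have hη3 : |(1 + η) ^ 2 - 1| ≤ 3 * |η| := by
    rw [show (1 + η) ^ 2 - 1 = η * (2 + η) by ring, abs_mul, mul_comm]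
    refine mul_le_mul_of_nonneg_right ?_ (abs_nonneg η)
    rw [abs_le]; constructor <;> linarith [le_abs_self η, neg_abs_le η]
  -- assembly
  rw [re_weilQuadratic_weilDilate_sub hg hη1]
  have e1 : |(weilPolarTerm d).re| ≤ ‖weilPolarTerm d‖ := Complex.abs_re_le_norm _
  have e2 : |(weilPrimeTerm d).re| ≤ ‖weilPrimeTerm d‖ := Complex.abs_re_le_norm _
  have hπ : 0 < π := Real.pi_pos
  have hM₀ : 0 ≤ M₀ := (norm_nonneg _).trans (hdM 0)
  have key : |(weilPolarTerm d).re - (weilPrimeTerm d).re +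
      1 / (2 * π) * ((weilArchIntegral (fun t ↦ k ((1 + η) * t))).re - (weilArchIntegral k).re)| ≤
      ‖weilPolarTerm d‖ + ‖weilPrimeTerm d‖ +
        1 / (2 * π) * (27 * |(1 + η) ^ 2 - 1| * M ^ 2 * (2 * π) + D / R * B) := by
    refine (abs_add_le _ _).trans (add_le_add ((abs_sub _ _).trans (add_le_add e1 e2)) ?_)
    rw [abs_mul, abs_of_pos (by positivity : (0 : ℝ) < 1 / (2 * π))]
    exact mul_le_mul_of_nonneg_left hA (by positivity)
  refine key.trans ?_
  have e3 : 1 / (2 * π) * (27 * |(1 + η) ^ 2 - 1| * M ^ 2 * (2 * π) + D / R * B) =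
      27 * |(1 + η) ^ 2 - 1| * M ^ 2 + D * B / (2 * π * R) := by
    field_simp
  rw [e3]
  have e4 : 27 * |(1 + η) ^ 2 - 1| * M ^ 2 ≤ 81 * |η| * M ^ 2 := by nlinarith [sq_nonneg M]
  have e5 : Real.exp (4 * a / 2) = Real.exp (2 * a) := by congr 1; ring
  rw [e5] at hPol
  nlinarith [hPol, hPr, (Real.exp_pos (2 * a)).le, hM₀,
    Finset.sum_nonneg (fun n _ ↦ div_nonneg ArithmeticFunction.vonMangoldt_nonneg (Real.sqrt_nonneg _) :
      ∀ n ∈ Finset.range (⌊Real.exp (4 * a)⌋₊ + 1), (0 : ℝ) ≤ (Λ n : ℝ) / Real.sqrt n)]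

end Dilation

/-! ## The uniform dilation modulus on the unit sphere of a window -/

/-- **KEY (uniform continuity of `Q` under small dilations, on energy-bounded parts of the unit
sphere of a window).** For every window `a > 0`, energy cap `E` and `ε > 0` there is `δ ∈ (0, 1/2]`
such that for every `|η| ≤ δ` and every `L²`-normalised test function `g` supported in `[-a, a]` with
`Re Q(g) ≤ E`: `|Re Q(g_η) − Re Q(g)| ≤ ε`, `g_η = weilDilate η g`.
Proof: in the master estimate choose `λ`, then `M` large (`ρ(M) → ∞` kills the two tail terms,
the energy `B ≤ 2π(E + C(a))` being uniformly bounded), then `δ` small. This is the minimiser-free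
form of Suzuki's two semicontinuity arguments (§4.3: `R(a, w) → R(a₀, w)` for fixed `w`; §4.4:
`H^{log}`-boundedness of minimising sequences). [cite: Suzuki2026, §4.3–§4.4 (proof of Thm. 1.3)] -/
theorem exists_weilDilate_modulus {a : ℝ} (ha : 0 < a) (E : ℝ) {ε : ℝ} (hε : 0 < ε) :
    ∃ δ : ℝ, 0 < δ ∧ δ ≤ 1 / 2 ∧ ∀ η : ℝ, |η| ≤ δ → ∀ g : ℝ → ℂ, IsWeilTest g →
      tsupport g ⊆ Icc (-a) a → ∫ t : ℝ, ‖g t‖ ^ 2 = (1 : ℝ) → (weilQuadratic g).re ≤ E →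
        |(weilQuadratic (weilDilate η g)).re - (weilQuadratic g).re| ≤ ε := by
  obtain ⟨D, hD0, hD⟩ := exists_abs_reDigammaQuarter_sub_le_of_comparable
  -- constants of the window (opaque reals with defining equations)
  obtain ⟨S, hS⟩ : ∃ S : ℝ, S = ∑ n ∈ Finset.range (⌊Real.exp (4 * a)⌋₊ + 1),
    (Λ n : ℝ) / Real.sqrt n := ⟨_, rfl⟩
  have hS0 : 0 ≤ S := hS ▸
    Finset.sum_nonneg fun n _ ↦ div_nonneg ArithmeticFunction.vonMangoldt_nonneg (Real.sqrt_nonneg _)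
  obtain ⟨K, hK⟩ : ∃ K : ℝ, K = 16 * a * Real.exp (2 * a) + 2 * S := ⟨_, rfl⟩
  have hK0 : 0 ≤ K := by rw [hK]; positivity
  obtain ⟨C, hC⟩ : ∃ C : ℝ, C = 2 * (Real.sinh a - a) +
    2 * (∑ n ∈ Finset.range (⌊Real.exp (2 * a)⌋₊ + 1), (Λ n : ℝ) / Real.sqrt n) +
      Real.log π - reDigammaQuarter 0 := ⟨_, rfl⟩
  obtain ⟨Bbar, hBbar⟩ : ∃ Bbar : ℝ, Bbar = max 0 (2 * π * (E + C)) := ⟨_, rfl⟩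
  have hBbar0 : 0 ≤ Bbar := by rw [hBbar]; exact le_max_left _ _
  have hBbar1 : 2 * π * (E + C) ≤ Bbar := by rw [hBbar]; exact le_max_right _ _
  -- the choice of `λ`
  have hK1 : 0 < K + 1 := by linarith only [hK0]
  obtain ⟨lam, hlam⟩ : ∃ lam : ℝ, lam = ε / (2 * (K + 1)) := ⟨_, rfl⟩
  have hlam0 : 0 < lam := by rw [hlam]; positivity
  have hlamK : (K + 1) * lam = ε / 2 := by rw [hlam]; field_simp
  obtain ⟨Xt, hXt⟩ : ∃ Xt : ℝ, Xt = ε * lam / (2 * (K + 1)) := ⟨_, rfl⟩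
  have hXt0 : 0 < Xt := by rw [hXt]; positivity
  have hXtlam : lam⁻¹ * Xt = ε / (2 * (K + 1)) := by
    rw [hXt]; field_simp
  -- the choice of `M`
  have hRt : Tendsto (fun M : ℝ ↦ reDigammaQuarter M - reDigammaQuarter 0) atTop atTop :=
    tendsto_atTop_add_const_right _ _ tendsto_reDigammaQuarter_atTop
  have hlim1 : Tendsto (fun M : ℝ ↦ (2 * Bbar / π) / (reDigammaQuarter M - reDigammaQuarter 0))
      atTop (𝓝 0) := tendsto_const_nhds.div_atTop hRt
  have hlim2 : Tendsto (fun M : ℝ ↦ (D * Bbar / (2 * π)) / (reDigammaQuarter M - reDigammaQuarter 0))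
      atTop (𝓝 0) := tendsto_const_nhds.div_atTop hRt
  obtain ⟨M, hM, hM1, hM2⟩ : ∃ M : ℝ, 0 < reDigammaQuarter M - reDigammaQuarter 0 ∧
      (2 * Bbar / π) / (reDigammaQuarter M - reDigammaQuarter 0) ≤ Xt / 2 ∧
      (D * Bbar / (2 * π)) / (reDigammaQuarter M - reDigammaQuarter 0) ≤ ε / 4 :=
    ((hRt.eventually_gt_atTop 0).and ((hlim1.eventually (Iic_mem_nhds (by positivity))).and
      (hlim2.eventually (Iic_mem_nhds (by positivity))))).exists
  have hM' : reDigammaQuarter 0 < reDigammaQuarter M := sub_pos.1 hM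
  obtain ⟨R, hR⟩ : ∃ R : ℝ, R = reDigammaQuarter M - reDigammaQuarter 0 := ⟨_, rfl⟩
  rw [← hR] at hM hM1 hM2
  -- the choice of `δ`
  obtain ⟨P, hP⟩ : ∃ P : ℝ, P = 16 * a ^ 2 * M ^ 2 := ⟨_, rfl⟩
  have hP0 : 0 ≤ P := by rw [hP]; positivity
  obtain ⟨δ, hδ⟩ : ∃ δ : ℝ, δ = min (1 / 2) (min (Xt / (2 * (P + 1))) (ε / (4 * (81 * M ^ 2 + 1)))) :=
    ⟨_, rfl⟩
  have hδ0 : 0 < δ := by rw [hδ]; positivity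
  have hδ1 : δ ≤ 1 / 2 := by rw [hδ]; exact min_le_left _ _
  have hδ2 : δ ≤ Xt / (2 * (P + 1)) := by
    rw [hδ]; exact (min_le_right _ _).trans (min_le_left _ _)
  have hδ3 : δ ≤ ε / (4 * (81 * M ^ 2 + 1)) := by
    rw [hδ]; exact (min_le_right _ _).trans (min_le_right _ _)
  refine ⟨δ, hδ0, hδ1, fun η hη g hg hsupp hN hE ↦ ?_⟩
  have hη2 : |η| ≤ 1 / 2 := hη.trans hδ1
  have master := abs_re_weilQuadratic_weilDilate_sub_le hg ha hsupp hN hη2 hlam0 hM' hD0 hD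
  rw [← hS, ← hK, ← hR] at master
  obtain ⟨B, hB⟩ : ∃ B : ℝ, B = ∫ u : ℝ, ‖weilMellin g (1 / 2 + u * I)‖ ^ 2 *
    (reDigammaQuarter u - reDigammaQuarter 0) := ⟨_, rfl⟩
  rw [← hB] at master
  have hB0 : 0 ≤ B := hB ▸ integral_nonneg fun u ↦
    mul_nonneg (sq_nonneg _) (sub_nonneg.2 (reDigammaQuarter_zero_le u))
  have hBle : B ≤ Bbar := by
    have h := integral_norm_sq_weilMellin_mul_sub_le hg hsupp
    rw [hN, mul_one, ← hC, ← hB] at h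
    exact h.trans ((mul_le_mul_of_nonneg_left (by linarith only [hE]) (by positivity)).trans hBbar1)
  obtain ⟨X, hX⟩ : ∃ X : ℝ, X = 16 * a ^ 2 * η ^ 2 * M ^ 2 + 2 * B / (π * R) := ⟨_, rfl⟩
  rw [← hX] at master
  -- `X ≤ Xt`
  have hXle : X ≤ Xt := by
    have h1 : η ^ 2 ≤ δ := by
      have h' : η ^ 2 ≤ δ ^ 2 := by
        rw [← sq_abs η]; exact pow_le_pow_left₀ (abs_nonneg η) hη 2
      have h'' : δ ^ 2 ≤ δ := by nlinarith only [hδ0, hδ1]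
      exact h'.trans h''
    have h2 : 16 * a ^ 2 * η ^ 2 * M ^ 2 ≤ P * δ := by
      rw [hP, show 16 * a ^ 2 * η ^ 2 * M ^ 2 = 16 * a ^ 2 * M ^ 2 * η ^ 2 by ring]
      exact mul_le_mul_of_nonneg_left h1 (by positivity)
    have h3 : P * δ ≤ Xt / 2 := by
      refine (mul_le_mul_of_nonneg_left hδ2 hP0).trans ?_
      rw [mul_div_assoc', div_le_div_iff₀ (by positivity) (by positivity)]
      nlinarith only [hP0, hXt0]
    have h4 : 2 * B / (π * R) ≤ Xt / 2 := by
      have e : 2 * B / (π * R) = (2 * B / π) / R := by rw [div_div]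
      rw [e]
      refine le_trans ?_ hM1
      exact div_le_div_of_nonneg_right
        (div_le_div_of_nonneg_right (by linarith only [hBle]) Real.pi_pos.le) hM.le
    rw [hX]
    linarith only [h2, h3, h4]
  -- the four contributions
  have c1 : K * lam ≤ ε / 2 := by nlinarith only [hlamK, hlam0]
  have c2 : K * (lam⁻¹ * X) ≤ ε / 2 := by
    have h1 : lam⁻¹ * X ≤ ε / (2 * (K + 1)) := by
      rw [← hXtlam]
      exact mul_le_mul_of_nonneg_left hXle (inv_nonneg.2 hlam0.le)
    have h2 : K * (ε / (2 * (K + 1))) ≤ ε / 2 := by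
      rw [mul_div_assoc', div_le_div_iff₀ (by positivity) (by positivity)]
      nlinarith only [hε, hK0]
    exact (mul_le_mul_of_nonneg_left h1 hK0).trans h2
  have c3 : 81 * |η| * M ^ 2 ≤ ε / 4 := by
    have h1 : 81 * |η| * M ^ 2 ≤ 81 * M ^ 2 * δ := by
      rw [show 81 * |η| * M ^ 2 = 81 * M ^ 2 * |η| by ring]
      exact mul_le_mul_of_nonneg_left hη (by positivity)
    have h2 : 81 * M ^ 2 * δ ≤ ε / 4 := by
      refine (mul_le_mul_of_nonneg_left hδ3 (by positivity : (0 : ℝ) ≤ 81 * M ^ 2)).trans ?_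
      rw [mul_div_assoc', div_le_div_iff₀ (by positivity) (by positivity)]
      nlinarith only [hε, sq_nonneg M]
    exact h1.trans h2
  have c4 : D * B / (2 * π * R) ≤ ε / 4 := by
    have e : D * B / (2 * π * R) = (D * B / (2 * π)) / R := by rw [div_div]
    rw [e]
    refine le_trans ?_ hM2
    refine div_le_div_of_nonneg_right (div_le_div_of_nonneg_right ?_ (by positivity)) hM.le
    exact mul_le_mul_of_nonneg_left hBle hD0
  have hsum : K * ((lam + lam⁻¹ * X) / 2) ≤ ε / 2 := by nlinarith only [c1, c2]
  linarith only [master, hsum, c3, c4]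

/-! ## Continuity of the ground energy -/

/-- Elements of the unit sphere of the window bound the ground energy from above. [folklore] -/
theorem weilGroundEnergy_le_re_weilQuadratic {a : ℝ} {h : ℝ → ℂ} (hh : IsWeilTest h)
    (hs : tsupport h ⊆ Icc (-a) a) (hn : ∫ t : ℝ, ‖h t‖ ^ 2 = (1 : ℝ)) :
    weilGroundEnergy a ≤ (weilQuadratic h).re :=
  csInf_le (bddBelow_weilQuadratic_sphere_holds a) ⟨h, hh, hs, hn, rfl⟩

/-- A lower bound valid on the whole unit sphere of a window `a > 0` bounds the ground energy from
below (the sphere is nonempty). [folklore] -/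
theorem le_weilGroundEnergy_of_forall {a b : ℝ} (ha : 0 < a)
    (hb : ∀ h : ℝ → ℂ, IsWeilTest h → tsupport h ⊆ Icc (-a) a → ∫ t : ℝ, ‖h t‖ ^ 2 = (1 : ℝ) →
      b ≤ (weilQuadratic h).re) :
    b ≤ weilGroundEnergy a := by
  obtain ⟨g, hg, hs, hn⟩ := exists_isWeilTest_sphere ha
  refine le_csInf ⟨_, g, hg, hs, hn, rfl⟩ ?_
  rintro x ⟨h, hh, hhs, hhn, rfl⟩
  exact hb h hh hhs hhn

/-- Near-minimisers exist: for `a > 0` and `ε > 0` there is an element of the unit sphere of the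
window with `Re Q(g) < ε(a) + ε`. [folklore] -/
theorem exists_re_weilQuadratic_lt {a ε : ℝ} (ha : 0 < a) (hε : 0 < ε) :
    ∃ g : ℝ → ℂ, IsWeilTest g ∧ tsupport g ⊆ Icc (-a) a ∧ ∫ t : ℝ, ‖g t‖ ^ 2 = (1 : ℝ) ∧
      (weilQuadratic g).re < weilGroundEnergy a + ε := by
  obtain ⟨g₁, hg₁, hs₁, hn₁⟩ := exists_isWeilTest_sphere ha
  obtain ⟨x, ⟨g, hg, hs, hn, rfl⟩, hlt⟩ := exists_lt_of_csInf_lt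
    (s := {x : ℝ | ∃ g : ℝ → ℂ, IsWeilTest g ∧ tsupport g ⊆ Icc (-a) a ∧
      ∫ t : ℝ, ‖g t‖ ^ 2 = 1 ∧ x = (weilQuadratic g).re})
    ⟨_, g₁, hg₁, hs₁, hn₁, rfl⟩ (lt_add_of_pos_right (weilGroundEnergy a) hε)
  exact ⟨g, hg, hs, hn, hlt⟩

/-- **Continuity of the ground energy at every window `a₀ > 0`.** Upper bound near `a₀`: dilate a
near-minimiser of the window `a₀` into the window `a` (`η = a₀/a − 1`). Lower bound near `a₀`:
dilate every energy-bounded element of the unit sphere of the window `a ≤ 2a₀` into the window `a₀`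
(`η = a/a₀ − 1`); elements of energy `> ε(a₀) + 1` need no argument. Both use the uniform modulus
`exists_weilDilate_modulus`. [cite: Suzuki2026, Thm. 1.3] -/
theorem continuousAt_weilGroundEnergy {a₀ : ℝ} (ha₀ : 0 < a₀) :
    ContinuousAt weilGroundEnergy a₀ := by
  rw [Metric.continuousAt_iff]
  intro ε hε
  obtain ⟨g₀, hg₀, hs₀, hn₀, hlt⟩ := exists_re_weilQuadratic_lt ha₀ (half_pos hε)
  obtain ⟨δ₁, hδ₁, -, h₁⟩ := exists_weilDilate_modulus ha₀ ((weilQuadratic g₀).re) (half_pos hε)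
  obtain ⟨δ₂, hδ₂, -, h₂⟩ :=
    exists_weilDilate_modulus (a := 2 * a₀) (by positivity) (weilGroundEnergy a₀ + 1) (half_pos hε)
  refine ⟨min (a₀ / 2) (min (δ₁ * a₀ / 2) (δ₂ * a₀ / 2)), by positivity, fun a ha ↦ ?_⟩
  rw [Real.dist_eq] at ha ⊢
  have ha1 : |a - a₀| < a₀ / 2 := lt_of_lt_of_le ha (min_le_left _ _)
  have ha2 : |a - a₀| < δ₁ * a₀ / 2 := lt_of_lt_of_le ha ((min_le_right _ _).trans (min_le_left _ _))
  have ha3 : |a - a₀| < δ₂ * a₀ / 2 := lt_of_lt_of_le ha ((min_le_right _ _).trans (min_le_right _ _))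
  rw [abs_lt] at ha1 ha2 ha3
  have hapos : a₀ / 2 < a := by linarith [ha1.1]
  have ha0 : 0 < a := by linarith
  have hale : a ≤ 2 * a₀ := by linarith [ha1.2]
  rw [abs_sub_lt_iff]
  constructor
  · -- upper bound: `ε(a) < ε(a₀) + ε`
    set η : ℝ := a₀ / a - 1 with hη
    have hη1 : -1 < η := by
      have : 0 < a₀ / a := div_pos ha₀ ha0
      rw [hη]; linarith
    have hηabs : |η| ≤ δ₁ := by
      rw [hη, show a₀ / a - 1 = (a₀ - a) / a by field_simp, abs_div, abs_of_pos ha0,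
        div_le_iff₀ ha0, abs_sub_comm]
      nlinarith [ha2.1, ha2.2, abs_lt.2 ⟨ha2.1, ha2.2⟩]
    have hwin : a₀ / (1 + η) = a := by
      rw [show 1 + η = a₀ / a by rw [hη]; ring, div_div_eq_mul_div, mul_div_cancel_left₀ _ ha₀.ne']
    have hh : IsWeilTest (weilDilate η g₀) := hg₀.weilDilate hη1
    have hhs : tsupport (weilDilate η g₀) ⊆ Icc (-a) a := by
      have := tsupport_weilDilate_subset g₀ hη1 hs₀
      rwa [hwin] at this
    have hhn : ∫ t : ℝ, ‖weilDilate η g₀ t‖ ^ 2 = 1 := by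
      rw [integral_norm_sq_weilDilate g₀ hη1, hn₀]
    have hle := weilGroundEnergy_le_re_weilQuadratic hh hhs hhn
    have hkey := h₁ η hηabs g₀ hg₀ hs₀ hn₀ le_rfl
    rw [abs_le] at hkey
    linarith [hkey.2]
  · -- lower bound: `ε(a₀) − ε < ε(a)`
    have hlb : weilGroundEnergy a₀ - ε / 2 ≤ weilGroundEnergy a := by
      refine le_weilGroundEnergy_of_forall ha0 fun h hh hhs hhn ↦ ?_
      by_cases hE : (weilQuadratic h).re ≤ weilGroundEnergy a₀ + 1
      · set η : ℝ := a / a₀ - 1 with hη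
        have hη1 : -1 < η := by
          have : 0 < a / a₀ := div_pos ha0 ha₀
          rw [hη]; linarith
        have hηabs : |η| ≤ δ₂ := by
          rw [hη, show a / a₀ - 1 = (a - a₀) / a₀ by field_simp, abs_div, abs_of_pos ha₀,
            div_le_iff₀ ha₀]
          nlinarith [ha3.1, ha3.2, abs_lt.2 ⟨ha3.1, ha3.2⟩]
        have hwin : a / (1 + η) = a₀ := by
          rw [show 1 + η = a / a₀ by rw [hη]; ring, div_div_eq_mul_div,
            mul_div_cancel_left₀ _ ha0.ne']
        have hhs' : tsupport h ⊆ Icc (-(2 * a₀)) (2 * a₀) :=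
          hhs.trans (Icc_subset_Icc (by linarith) hale)
        have hh' : IsWeilTest (weilDilate η h) := hh.weilDilate hη1
        have hhs'' : tsupport (weilDilate η h) ⊆ Icc (-a₀) a₀ := by
          have := tsupport_weilDilate_subset h hη1 hhs
          rwa [hwin] at this
        have hhn' : ∫ t : ℝ, ‖weilDilate η h t‖ ^ 2 = 1 := by
          rw [integral_norm_sq_weilDilate h hη1, hhn]
        have hle := weilGroundEnergy_le_re_weilQuadratic hh' hhs'' hhn'
        have hkey := h₂ η hηabs h hh hhs' hhn hE
        rw [abs_le] at hkey
        linarith [hkey.1]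
      · have hE' := not_le.1 hE
        linarith
    linarith

/-- **Discharge of `Literature.NumberTheory.LFunctions.Suzuki2026_thm_1_3`** (M. Suzuki, *Weil's
quadratic form via the screw function*, arXiv:2606.09096, Thm. 1.3: "The lowest eigenvalue `λ_a` is
continuous in `a`"; `λ_a = weilGroundEnergy a` by Cor. 1.2): `a ↦ ε(a)` is continuous on `(0, ∞)`.

The printed proof (§4) rescales the window to `[-1, 1]`, writes the Rayleigh quotient as
`R(a, w) = −log a − (2A+1) + 𝓛(w)/‖w‖² − (prime terms)(a, w) − a∬ r''(a(x−y)) w w̄`, and proves upper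
semicontinuity from `R(a, w) → R(a₀, w)` for fixed smooth `w` (§4.3) and lower semicontinuity from
the `H^{log}`-boundedness of minimisers and the compact embedding `H^{log} ↪ L²` (Prop. 4.1, §4.4).
The present proof uses the same mechanism — the scale covariance of the logarithmic singularity and
the `H^{log}` control of translations — in a minimiser-free form: one uniform estimate
(`exists_weilDilate_modulus`) for `|Re Q(g_η) − Re Q(g)|` over energy-bounded normalised test
functions of a window, obtained from (i) Plancherel for translates (`two_pi_mul_weilIncrement_le`:
the translation modulus is small uniformly, the tail mass of `|ĝ|²` being `≤ B/(ρ(M) − ρ(0))`),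
(ii) the increments of the autocorrelation `k = g ⋆ g̃` (polar and prime terms through the difference
kernel `k((1+η)·) − k`), (iii) the archimedean integral on the Fourier side,
`∫ |ĝ|² (ρ((1+η)u) − ρ(u)) du` with `|ρ(cu) − ρ(u)| ≤ 27|c²−1|u²` on `|u| ≤ M` and `≤ D` beyond;
then both one-sided bounds of `ε(a)` near `a₀` follow by dilating near-minimisers
(`continuousAt_weilGroundEnergy`). [cite: Suzuki2026, Thm. 1.3 and §4] -/
theorem Suzuki2026_thm_1_3_holds : Suzuki2026_thm_1_3 :=
  fun _ ha ↦ (continuousAt_weilGroundEnergy ha).continuousWithinAt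

end Literature.NumberTheory.LFunctions

end
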